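import Mathlib.NumberTheory.Chebyshev
import Literature.Analysis.Complex.WeightedArgumentPrinciple
import Literature.Analysis.Complex.RectangleCauchyFormula
import Literature.NumberTheory.LFunctions.PerronTruncated
import Literature.NumberTheory.LFunctions.ZetaLogDerivDisc
import Literature.NumberTheory.LFunctions.ZetaLogDerivRH
import Literature.NumberTheory.LFunctions.ZetaZerosJensen
import Literature.NumberTheory.LFunctions.VonKochEquivalence
import HarnessLib

/-!
# Von Koch's theorem: RH implies `ψ(x) = x + O(x^{1/2} log² x)` (Montgomery–Vaughan Thm. 13.1)

Trunk T-ANT (`NumberTheory/LFunctions`), family RH. H. von Koch, *Sur la distribution des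
nombres premiers*, Acta Math. 24 (1901), 159–182; Montgomery–Vaughan, *Multiplicative Number
Theory I*, Thm. 13.1: "Assume RH. Then `ψ(x) = x + O(x^{1/2} (log x)²)`." This file PROVES the
tree's named fact `Literature.NumberTheory.LFunctions.vonKoch_chebyshevPsi_of_riemannHypothesis` (`VonKochEquivalence.lean`):

* `Literature.NumberTheory.LFunctions.vonKoch_chebyshevPsi_of_riemannHypothesis_holds`.

**Proof** (MV §13.1 with the contour of §12.1 stopped at `σ = 1/4`, which suffices under RH).
For a half-integer `x = N + 1/2` put `c = 1 + 1/log x` and integrate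
`F(s) = (−ζ'/ζ)(s) x^s/s = (−ζ₁'/ζ₁(s) + 1/(s−1)) x^s/s` (`ζ₁ = (s−1)ζ`, entire) over the boundary
of `R = [1/4, c] × [T₂, T₁]`, where `T₁ ∈ [x, x+1]`, `T₂ ∈ [−x−1, −x]` are the good heights of
MV Lemma 12.2 (`Literature.NumberTheory.LFunctions.ZetaLogDerivRH.exists_goodHeight`, `Literature.NumberTheory.LFunctions.norm_logDeriv_zeta_le_of_goodHeight`,
`ZetaLogDerivRH.lean`).
1. Residues (`Literature.NumberTheory.LFunctions.rectBoundaryIntegral_vonKoch_eq`): by the weighted argument principle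
   (`Literature.Analysis.Complex.integral_boundary_rect_logDeriv_mul`) and Cauchy's formula for `x^s/(s(s−1))`
   (`Literature.Analysis.Complex.rectBoundaryIntegral_const_mul_div_sub`),
   `∮_{∂R} F = 2πi (x − ∑_{ρ ∈ R°} m(ρ) x^ρ/ρ)`.
2. Right side `= 2πi ψ(x) + O(log² x)`: the truncated Perron formula
   `Literature.NumberTheory.LFunctions.exists_norm_perron_vonMangoldt_sub_le` (`PerronTruncated.lean`, MV Cor. 5.3).
3. Horizontal sides `≪ log² x` (`|ζ'/ζ| ≪ log² x` there, `|x^s/s| ≤ ex/x`); left side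
   `≪ x^{1/4} log² x` under RH (`Literature.NumberTheory.LFunctions.norm_logDeriv_zeta_quarter_le`, `ZetaLogDerivRH.lean`).
4. Under RH `|x^ρ| = x^{1/2}` and `∑_{|γ| ≤ x+1} m(ρ)/|ρ| ≪ log² x`
   (`Literature.NumberTheory.LFunctions.exists_sum_zeroOrder_div_norm_le`, `ZetaZerosJensen.lean`, MV (13.1)).
Hence `ψ(x) = x + O(x^{1/2} log² x)` at half-integers, and at all `x` since `ψ` is a step
function. Everything in this file is proved (no named facts are assumed).

## References

* H. von Koch, *Sur la distribution des nombres premiers*, Acta Math. 24 (1901), 159–182.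
* H. L. Montgomery, R. C. Vaughan, *Multiplicative Number Theory I. Classical Theory*, CUP 2007,
  §5.1 Cor. 5.3, §12.1 Lemmas 12.1–12.2, Thm. 12.5, §13.1 Thm. 13.1 and eq. (13.1).
* J. B. Conway, *Functions of One Complex Variable I*, 2nd ed., GTM 11, Ch. V Thm. 3.6.
-/

noncomputable section

open Complex Set MeasureTheory Filter Topology intervalIntegral Real Asymptotics
open scoped Chebyshev

namespace Literature.NumberTheory.LFunctions

/-! ### The integrand `F(s) = (−ζ₁'/ζ₁(s) + 1/(s−1)) · x^s/s` -/

/-- Continuity of the explicit-formula integrand `(−ζ₁'/ζ₁(s) + 1/(s−1)) x^s/s` at a point where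
`ζ₁(s) ≠ 0`, `s ≠ 0, 1`. [folklore] -/
theorem continuousAt_vonKochIntegrand {x : ℝ} (hx : 0 < x) {s : ℂ} (hζ : riemannZeta₁ s ≠ 0)
    (hs0 : s ≠ 0) (hs1 : s ≠ 1) :
    ContinuousAt (fun s : ℂ ↦ (-(deriv riemannZeta₁ s / riemannZeta₁ s) + (s - 1)⁻¹) *
      ((x : ℂ) ^ s / s)) s := by
  have h1 : ContinuousAt (deriv riemannZeta₁) s :=
    (differentiable_riemannZeta₁.analyticAt s).deriv.continuousAt
  have h2 : ContinuousAt riemannZeta₁ s := (differentiable_riemannZeta₁ s).continuousAt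
  have h3 : ContinuousAt (fun s : ℂ ↦ (x : ℂ) ^ s) s :=
    continuousAt_const_cpow (ofReal_ne_zero.2 hx.ne')
  have h4 : ContinuousAt (fun s : ℂ ↦ (s - 1)⁻¹) s :=
    (continuousAt_id.sub continuousAt_const).inv₀ (sub_ne_zero.2 hs1)
  exact ((h1.div h2 hζ).neg.add h4).mul (h3.div continuousAt_id hs0)

/-- Where `ζ(s) ≠ 0` and `s ≠ 1` the integrand is `(−ζ'/ζ)(s) x^s/s`
(`ζ'/ζ = ζ₁'/ζ₁ − 1/(s−1)`, `Literature.NumberTheory.LFunctions.logDeriv_riemannZeta_eq`). [folklore] -/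
theorem vonKochIntegrand_eq (x : ℝ) {s : ℂ} (hs1 : s ≠ 1) (hζ : riemannZeta s ≠ 0) :
    (fun s : ℂ ↦ (-(deriv riemannZeta₁ s / riemannZeta₁ s) + (s - 1)⁻¹) * ((x : ℂ) ^ s / s)) s =
      (-deriv riemannZeta s / riemannZeta s) * ((x : ℂ) ^ s / s) := by
  have h := logDeriv_riemannZeta_eq hs1 hζ
  rw [logDeriv_apply, logDeriv_apply] at h
  simp only []
  rw [neg_div, h]
  ring

/-- On the line `Re s = c > 1` the integrand is `(−ζ'/ζ)(s) x^s/s`. [folklore] -/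
theorem vonKochIntegrand_eq_of_one_lt (x : ℝ) {c : ℝ} (hc : 1 < c) (t : ℝ) :
    (fun s : ℂ ↦ (-(deriv riemannZeta₁ s / riemannZeta₁ s) + (s - 1)⁻¹) * ((x : ℂ) ^ s / s))
        (c + t * I) =
      (-deriv riemannZeta (c + t * I) / riemannZeta (c + t * I)) *
        ((x : ℂ) ^ ((c : ℂ) + t * I) / ((c : ℂ) + t * I)) := by
  have hre : ((c : ℂ) + t * I).re = c := by simp
  have hs1 : ((c : ℂ) + t * I) ≠ 1 := by
    intro h; have := congrArg Complex.re h; rw [hre] at this; simp at this; linarith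
  exact vonKochIntegrand_eq x hs1 (riemannZeta_ne_zero_of_one_lt_re (by rw [hre]; exact hc))

/-! ### The residue identity on the rectangle `[a, b] × [lo, hi]` -/

/-- **The explicit formula on a rectangle** (Montgomery–Vaughan §12.1, residue computation in
the proof of Thm. 12.5, restricted to `Re s ≥ a > 0`). For `x > 0`, `0 < a < 1 < b`,
`lo < 0 < hi`, and `ζ₁ ≠ 0` on the boundary of `R = [a, b] × [lo, hi]`,
`∮_{∂R} (−ζ₁'/ζ₁(s) + 1/(s−1)) x^s/s ds = 2πi (x − ∑_{ρ ∈ R°, ζ(ρ) = 0} m(ρ) x^ρ/ρ)`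
(four-term boundary convention of `Literature.Analysis.Complex.rectBoundaryIntegral`; `m(ρ)` the multiplicity).
The pole of `−ζ'/ζ · x^s/s` at `s = 1` has residue `x`; the pole at `s = 0` lies outside `R`.
[cite: MontgomeryVaughan2007, Thm. 12.5 (proof)] -/
theorem rectBoundaryIntegral_vonKoch_eq {x a b lo hi : ℝ} (hx : 0 < x) (ha0 : 0 < a) (ha1 : a < 1)
    (hb : 1 < b) (hlo : lo < 0) (hhi : 0 < hi)
    (h_bot : ∀ σ ∈ Icc a b, riemannZeta₁ (σ + lo * I) ≠ 0)
    (h_top : ∀ σ ∈ Icc a b, riemannZeta₁ (σ + hi * I) ≠ 0)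
    (h_left : ∀ t ∈ Icc lo hi, riemannZeta₁ (a + t * I) ≠ 0)
    (h_right : ∀ t ∈ Icc lo hi, riemannZeta₁ (b + t * I) ≠ 0) :
    Literature.Analysis.Complex.rectBoundaryIntegral
        (fun s : ℂ ↦ (-(deriv riemannZeta₁ s / riemannZeta₁ s) + (s - 1)⁻¹) * ((x : ℂ) ^ s / s))
        a b lo hi =
      2 * π * I * ((x : ℂ) - ∑ᶠ ρ ∈ {ρ : ℂ | riemannZeta₁ ρ = 0 ∧ ρ ∈ Ioo a b ×ℂ Ioo lo hi},
        ((meromorphicOrderAt riemannZeta₁ ρ).untop₀ : ℂ) * ((x : ℂ) ^ ρ / ρ)) := by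
  classical
  have hab : a < b := ha1.trans hb
  have hcd : lo < hi := hlo.trans hhi
  set g : ℂ → ℂ := fun s ↦ (x : ℂ) ^ s / s with hg
  -- points of the closed rectangle
  have hK0 : ∀ s ∈ Icc a b ×ℂ Icc lo hi, s ≠ 0 := by
    intro s hs h0
    have h1 : a ≤ s.re := (mem_reProdIm.1 hs).1.1
    rw [h0, Complex.zero_re] at h1
    linarith
  have hgd : ∀ s : ℂ, s ≠ 0 → DifferentiableAt ℂ g s := fun s hs ↦
    (differentiableAt_id.const_cpow (Or.inl (ofReal_ne_zero.2 hx.ne'))).div differentiableAt_id hs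
  have hgD : DifferentiableOn ℂ g {(0 : ℂ)}ᶜ := fun s hs ↦ (hgd s hs).differentiableWithinAt
  have hgA' : AnalyticOnNhd ℂ g {(0 : ℂ)}ᶜ := hgD.analyticOnNhd isOpen_compl_singleton
  have hgA : AnalyticOnNhd ℂ g (Icc a b ×ℂ Icc lo hi) := hgA'.mono fun s hs ↦ hK0 s hs
  have hfA : AnalyticOnNhd ℂ riemannZeta₁ (Icc a b ×ℂ Icc lo hi) := fun s _ ↦
    differentiable_riemannZeta₁.analyticAt s
  -- (1) the weighted argument principle for `ζ₁` and `g`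
  have h1 := Literature.Analysis.Complex.integral_boundary_rect_logDeriv_mul hab hcd hfA hgA h_bot h_top h_left
    h_right
  have h1' : Literature.Analysis.Complex.rectBoundaryIntegral
      (fun z ↦ deriv riemannZeta₁ z / riemannZeta₁ z * g z) a b lo hi =
      2 * π * I * ∑ᶠ ρ ∈ {ρ : ℂ | riemannZeta₁ ρ = 0 ∧ ρ ∈ Ioo a b ×ℂ Ioo lo hi},
        ((meromorphicOrderAt riemannZeta₁ ρ).untop₀ : ℂ) * g ρ := by
    rw [Literature.Analysis.Complex.rectBoundaryIntegral_def]
    exact h1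
  -- (2) Cauchy's formula for `g(s)/(s - 1)`: residue `g(1) = x`
  have h2 : Literature.Analysis.Complex.rectBoundaryIntegral (fun z ↦ (1 : ℂ) * (g z / (z - 1))) a b lo hi =
      2 * π * I * 1 * g 1 :=
    Literature.Analysis.Complex.rectBoundaryIntegral_const_mul_div_sub (g := g) 1 1 (by simpa using ha1)
      (by simpa using hb) (by simpa using hlo) (by simpa using hhi) hgA.differentiableOn
  -- (3) continuity of the two pieces on the boundary
  have hne1_of_im : ∀ {s : ℂ}, s.im ≠ 0 → s ≠ 1 := fun h h1 ↦ by
    apply h; rw [h1]; simp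
  have hne1_of_re : ∀ {s : ℂ}, s.re ≠ 1 → s ≠ 1 := fun h h1 ↦ by
    apply h; rw [h1]; simp
  have hcF₁ : ∀ s : ℂ, riemannZeta₁ s ≠ 0 → s ≠ 0 →
      ContinuousAt (fun z ↦ (-1 : ℂ) * (deriv riemannZeta₁ z / riemannZeta₁ z * g z)) s := by
    intro s hζ hs0
    have ha : ContinuousAt (deriv riemannZeta₁) s :=
      (differentiable_riemannZeta₁.analyticAt s).deriv.continuousAt
    have hb' : ContinuousAt riemannZeta₁ s := (differentiable_riemannZeta₁ s).continuousAt
    exact continuousAt_const.mul ((ha.div hb' hζ).mul (hgd s hs0).continuousAt)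
  have hcF₂ : ∀ s : ℂ, s ≠ 0 → s ≠ 1 →
      ContinuousAt (fun z ↦ (1 : ℂ) * (g z / (z - 1))) s := by
    intro s hs0 hs1
    exact continuousAt_const.mul (((hgd s hs0).continuousAt).div
      (continuousAt_id.sub continuousAt_const) (sub_ne_zero.2 hs1))
  -- boundary points: `s ≠ 0` (as `Re s ≥ a > 0`) and `s ≠ 1`
  have h0_bot : ∀ σ ∈ Icc a b, ((σ : ℂ) + lo * I) ≠ 0 := fun σ hσ ↦
    hK0 _ (by simpa [mem_reProdIm] using ⟨hσ, hcd.le⟩)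
  have h0_top : ∀ σ ∈ Icc a b, ((σ : ℂ) + hi * I) ≠ 0 := fun σ hσ ↦
    hK0 _ (by simpa [mem_reProdIm] using ⟨hσ, hcd.le⟩)
  have h0_left : ∀ t ∈ Icc lo hi, ((a : ℂ) + t * I) ≠ 0 := fun t ht ↦
    hK0 _ (by simpa [mem_reProdIm] using ⟨hab.le, ht⟩)
  have h0_right : ∀ t ∈ Icc lo hi, ((b : ℂ) + t * I) ≠ 0 := fun t ht ↦
    hK0 _ (by simpa [mem_reProdIm] using ⟨hab.le, ht⟩)
  have h1_bot : ∀ σ : ℝ, ((σ : ℂ) + lo * I) ≠ 1 := fun σ ↦ hne1_of_im (by simp; exact hlo.ne)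
  have h1_top : ∀ σ : ℝ, ((σ : ℂ) + hi * I) ≠ 1 := fun σ ↦ hne1_of_im (by simp; exact hhi.ne')
  have h1_left : ∀ t : ℝ, ((a : ℂ) + t * I) ≠ 1 := fun t ↦ hne1_of_re (by simp; exact ha1.ne)
  have h1_right : ∀ t : ℝ, ((b : ℂ) + t * I) ≠ 1 := fun t ↦ hne1_of_re (by simp; exact hb.ne')
  -- (4) split the integrand and add up
  have hsplit : (fun s : ℂ ↦ (-(deriv riemannZeta₁ s / riemannZeta₁ s) + (s - 1)⁻¹) *
      ((x : ℂ) ^ s / s)) = fun s ↦ (-1 : ℂ) * (deriv riemannZeta₁ s / riemannZeta₁ s * g s) +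
        (1 : ℂ) * (g s / (s - 1)) := by
    funext s; simp only [hg]; ring
  rw [hsplit, Literature.Analysis.Complex.rectBoundaryIntegral_add hab.le hcd.le
      (fun σ hσ ↦ hcF₁ _ (h_bot σ hσ) (h0_bot σ hσ)) (fun σ hσ ↦ hcF₁ _ (h_top σ hσ) (h0_top σ hσ))
      (fun t ht ↦ hcF₁ _ (h_left t ht) (h0_left t ht))
      (fun t ht ↦ hcF₁ _ (h_right t ht) (h0_right t ht))
      (fun σ hσ ↦ hcF₂ _ (h0_bot σ hσ) (h1_bot σ)) (fun σ hσ ↦ hcF₂ _ (h0_top σ hσ) (h1_top σ))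
      (fun t ht ↦ hcF₂ _ (h0_left t ht) (h1_left t))
      (fun t ht ↦ hcF₂ _ (h0_right t ht) (h1_right t)),
    Literature.Analysis.Complex.rectBoundaryIntegral_const_mul, h1', h2]
  simp only [hg, Complex.cpow_one, div_one]
  ring

/-! ### Estimates for the three far sides -/

/-- **Horizontal sides.** For `x ≥ 1`, `1 < c ≤ 2` with `x^c = e·x`, `|T| ≥ x`, and
`‖ζ'/ζ(σ + iT)‖ ≤ M` on `1/4 ≤ σ ≤ 2` (a good height, MV Lemma 12.2),
`‖∫_{1/4}^{c} F(σ + iT) dσ‖ ≤ 2eM`, since `‖x^s/s‖ ≤ x^c/|T| ≤ e`.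
[cite: MontgomeryVaughan2007, Thm. 12.5 (proof)] -/
theorem norm_vonKoch_horizontal_le {x c T M : ℝ} (hx : 1 ≤ x) (hc1 : 1 < c) (hc2 : c ≤ 2)
    (hxc : x ^ c = Real.exp 1 * x) (hT : x ≤ |T|) (hM : 0 ≤ M)
    (h : ∀ σ ∈ Icc (1 / 4 : ℝ) 2, riemannZeta (σ + T * I) ≠ 0 ∧
      ‖deriv riemannZeta (σ + T * I) / riemannZeta (σ + T * I)‖ ≤ M) :
    ‖∫ σ in (1 / 4 : ℝ)..c, (fun s : ℂ ↦ (-(deriv riemannZeta₁ s / riemannZeta₁ s) + (s - 1)⁻¹) *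
        ((x : ℂ) ^ s / s)) (σ + T * I)‖ ≤ 2 * Real.exp 1 * M := by
  have hx0 : 0 < x := one_pos.trans_le hx
  have h14c : (1 / 4 : ℝ) ≤ c := by linarith
  have hbound : ∀ σ ∈ Set.uIoc (1 / 4 : ℝ) c,
      ‖(fun s : ℂ ↦ (-(deriv riemannZeta₁ s / riemannZeta₁ s) + (s - 1)⁻¹) * ((x : ℂ) ^ s / s))
        (σ + T * I)‖ ≤ Real.exp 1 * M := by
    intro σ hσ
    rw [uIoc_of_le h14c] at hσ
    have hσ' : σ ∈ Icc (1 / 4 : ℝ) 2 := ⟨hσ.1.le, hσ.2.trans hc2⟩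
    obtain ⟨hζ, hld⟩ := h σ hσ'
    have hTpos : 0 < |T| := hx0.trans_le hT
    have hs1 : ((σ : ℂ) + T * I) ≠ 1 := by
      intro h1
      have := congrArg Complex.im h1
      simp at this
      rw [this, abs_zero] at hTpos
      exact lt_irrefl _ hTpos
    rw [vonKochIntegrand_eq x hs1 hζ]
    set s : ℂ := σ + T * I with hs
    have hsre : s.re = σ := by simp [hs]
    have hsim : s.im = T := by simp [hs]
    -- ‖s‖ ≥ |T| ≥ x
    have hns : x ≤ ‖s‖ := hT.trans (by rw [← hsim]; exact abs_im_le_norm s)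
    have hns0 : 0 < ‖s‖ := hx0.trans_le hns
    -- the log-derivative factor
    have hA : ‖-deriv riemannZeta s / riemannZeta s‖ ≤ M := by rw [neg_div, norm_neg]; exact hld
    -- the kernel factor
    have hB : ‖(x : ℂ) ^ s / s‖ ≤ Real.exp 1 := by
      rw [norm_div, hs, norm_cpow_line hx0, ← hs]
      have hxσ : x ^ σ ≤ Real.exp 1 * x := by
        rw [← hxc]; exact Real.rpow_le_rpow_of_exponent_le hx hσ.2
      rw [div_le_iff₀ hns0]
      calc x ^ σ ≤ Real.exp 1 * x := hxσ
        _ ≤ Real.exp 1 * ‖s‖ := mul_le_mul_of_nonneg_left hns (Real.exp_pos 1).le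
    rw [norm_mul]
    calc ‖-deriv riemannZeta s / riemannZeta s‖ * ‖(x : ℂ) ^ s / s‖
        ≤ M * Real.exp 1 := mul_le_mul hA hB (norm_nonneg _) hM
      _ = Real.exp 1 * M := by ring
  refine (norm_integral_le_of_norm_le_const hbound).trans ?_
  have habs : |c - 1 / 4| ≤ 2 := by rw [abs_of_nonneg (by linarith)]; linarith
  have h0 : 0 ≤ Real.exp 1 * M := by positivity
  calc Real.exp 1 * M * |c - 1 / 4| ≤ Real.exp 1 * M * 2 :=
        mul_le_mul_of_nonneg_left habs h0
    _ = 2 * Real.exp 1 * M := by ring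

/-- `∫_{lo}^{hi} dt/(|t| + 1) ≤ 2 log(A + 1)` for `[lo, hi] ⊆ [−A, A]`. [folklore] -/
lemma integral_inv_abs_add_one_le {A lo hi : ℝ} (hA : 0 ≤ A) (hlo : -A ≤ lo) (hlohi : lo ≤ hi)
    (hhi : hi ≤ A) : ∫ t in lo..hi, (|t| + 1)⁻¹ ≤ 2 * Real.log (A + 1) := by
  have hcont : Continuous fun t : ℝ ↦ (|t| + 1)⁻¹ :=
    (continuous_abs.add continuous_const).inv₀ fun t ↦ (by positivity : (0 : ℝ) < |t| + 1).ne'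
  have hii : ∀ a b : ℝ, IntervalIntegrable (fun t : ℝ ↦ (|t| + 1)⁻¹) volume a b := fun a b ↦
    hcont.intervalIntegrable a b
  have hmono : ∫ t in lo..hi, (|t| + 1)⁻¹ ≤ ∫ t in (-A)..A, (|t| + 1)⁻¹ :=
    integral_mono_interval hlo hlohi hhi
      (Eventually.of_forall fun t ↦ (by positivity : (0 : ℝ) ≤ (|t| + 1)⁻¹)) (hii _ _)
  have hsplit : ∫ t in (-A)..A, (|t| + 1)⁻¹ =
      (∫ t in (-A)..0, (|t| + 1)⁻¹) + ∫ t in (0 : ℝ)..A, (|t| + 1)⁻¹ :=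
    (integral_add_adjacent_intervals (hii _ _) (hii _ _)).symm
  have hpos : ∫ t in (0 : ℝ)..A, (|t| + 1)⁻¹ = Real.log (A + 1) := by
    have e1 : ∫ t in (0 : ℝ)..A, (|t| + 1)⁻¹ = ∫ t in (0 : ℝ)..A, (t + 1)⁻¹ := by
      refine integral_congr fun t ht ↦ ?_
      rw [uIcc_of_le hA] at ht
      simp only [abs_of_nonneg ht.1]
    have e2 := intervalIntegral.integral_comp_add_right (a := 0) (b := A) (fun t : ℝ ↦ t⁻¹) 1
    simp only [zero_add] at e2
    rw [e1, e2, integral_inv_of_pos one_pos (by linarith), div_one]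
  have hneg : ∫ t in (-A)..0, (|t| + 1)⁻¹ = Real.log (A + 1) := by
    have e := intervalIntegral.integral_comp_neg (a := 0) (b := A) (fun t : ℝ ↦ (|t| + 1)⁻¹)
    simp only [abs_neg, neg_zero] at e
    rw [← e, hpos]
  linarith

/-- `‖s‖ ≥ (|t| + 1)/5` for `s = 1/4 + it`. [folklore] -/
lemma abs_add_one_le_five_mul_norm (t : ℝ) : |t| + 1 ≤ 5 * ‖(1 / 4 : ℂ) + t * I‖ := by
  have hn : ‖(1 / 4 : ℂ) + t * I‖ = Real.sqrt (1 / 16 + t ^ 2) := by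
    rw [Complex.norm_def, Complex.normSq_apply]
    congr 1
    simp; ring
  rw [hn]
  have h5 : (5 : ℝ) * Real.sqrt (1 / 16 + t ^ 2) = Real.sqrt (25 * (1 / 16 + t ^ 2)) := by
    rw [Real.sqrt_mul (by norm_num), show Real.sqrt 25 = 5 by
      rw [show (25 : ℝ) = 5 ^ 2 by norm_num, Real.sqrt_sq (by norm_num)]]
  rw [h5]
  refine Real.le_sqrt_of_sq_le ?_
  have ht : |t| ^ 2 = t ^ 2 := sq_abs t
  nlinarith [abs_nonneg t, sq_nonneg (|t| - 1 / 24)]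

/-- **The left side `σ = 1/4`.** For `x ≥ 1`, `[lo, hi] ⊆ [−x−1, x+1]` and
`‖ζ'/ζ(1/4 + it)‖ ≤ M` for `t ∈ [lo, hi]` (under RH, `M ≍ log x`),
`‖∫_{lo}^{hi} F(1/4 + it) dt‖ ≤ x^{1/4} M · 10 log(x + 2)`, since `‖x^s‖ = x^{1/4}` and
`1/‖s‖ ≤ 5/(|t| + 1)`. [cite: MontgomeryVaughan2007, Thm. 13.1 (proof)] -/
theorem norm_vonKoch_left_le {x lo hi M : ℝ} (hx : 1 ≤ x) (hlo : -(x + 1) ≤ lo) (hlohi : lo ≤ hi)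
    (hhi : hi ≤ x + 1) (hM : 0 ≤ M)
    (h : ∀ t ∈ Icc lo hi, riemannZeta (1 / 4 + t * I) ≠ 0 ∧
      ‖deriv riemannZeta (1 / 4 + t * I) / riemannZeta (1 / 4 + t * I)‖ ≤ M) :
    ‖∫ t in lo..hi, (fun s : ℂ ↦ (-(deriv riemannZeta₁ s / riemannZeta₁ s) + (s - 1)⁻¹) *
        ((x : ℂ) ^ s / s)) ((1 / 4 : ℝ) + t * I)‖ ≤
      x ^ (1 / 4 : ℝ) * M * (10 * Real.log (x + 2)) := by
  have hx0 : 0 < x := one_pos.trans_le hx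
  have e14 : ((1 / 4 : ℝ) : ℂ) = 1 / 4 := by push_cast; ring
  set K : ℝ := x ^ (1 / 4 : ℝ) * M with hK
  have hK0 : 0 ≤ K := by positivity
  have hbound : ∀ᵐ t : ℝ, t ∈ Ioc lo hi →
      ‖(fun s : ℂ ↦ (-(deriv riemannZeta₁ s / riemannZeta₁ s) + (s - 1)⁻¹) * ((x : ℂ) ^ s / s))
        ((1 / 4 : ℝ) + t * I)‖ ≤ K * (5 * (|t| + 1)⁻¹) := by
    refine Eventually.of_forall fun t ht ↦ ?_
    obtain ⟨hζ, hld⟩ := h t (Ioc_subset_Icc_self ht)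
    rw [e14]
    have hs1 : ((1 / 4 : ℂ) + t * I) ≠ 1 := by
      intro h1; have := congrArg Complex.re h1; norm_num at this
    rw [vonKochIntegrand_eq x hs1 hζ]
    set s : ℂ := 1 / 4 + t * I with hs
    have hsre : s.re = 1 / 4 := by simp [hs]
    have hsim : s.im = t := by simp [hs]
    have hns0 : 0 < ‖s‖ := by
      refine norm_pos_iff.2 fun h0 ↦ ?_
      have := congrArg Complex.re h0; rw [hsre] at this; simp at this
    have hA : ‖-deriv riemannZeta s / riemannZeta s‖ ≤ M := by rw [neg_div, norm_neg]; exact hld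
    have hxs : ‖(x : ℂ) ^ s‖ = x ^ (1 / 4 : ℝ) := by
      rw [Complex.norm_cpow_eq_rpow_re_of_pos hx0, hsre]
    have hinv : ‖s‖⁻¹ ≤ 5 * (|t| + 1)⁻¹ := by
      have h5 := abs_add_one_le_five_mul_norm t
      rw [← hs] at h5
      have hpos : 0 < |t| + 1 := by positivity
      rw [inv_le_comm₀ hns0 (by positivity), mul_inv, inv_inv]
      calc (5 : ℝ)⁻¹ * (|t| + 1) ≤ 5⁻¹ * (5 * ‖s‖) := by gcongr
        _ = ‖s‖ := by ring
    rw [norm_mul, norm_div ((x : ℂ) ^ s) s, hxs]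
    calc ‖-deriv riemannZeta s / riemannZeta s‖ * (x ^ (1 / 4 : ℝ) / ‖s‖)
        = ‖-deriv riemannZeta s / riemannZeta s‖ * x ^ (1 / 4 : ℝ) * ‖s‖⁻¹ := by
          rw [div_eq_mul_inv]; ring
      _ ≤ M * x ^ (1 / 4 : ℝ) * (5 * (|t| + 1)⁻¹) :=
          mul_le_mul (mul_le_mul_of_nonneg_right hA (by positivity)) hinv (by positivity)
            (mul_nonneg hM (by positivity))
      _ = K * (5 * (|t| + 1)⁻¹) := by rw [hK]; ring
  have hcont : Continuous fun t : ℝ ↦ K * (5 * (|t| + 1)⁻¹) :=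
    continuous_const.mul (continuous_const.mul
      ((continuous_abs.add continuous_const).inv₀ fun t ↦ (by positivity : (0 : ℝ) < |t| + 1).ne'))
  refine (norm_integral_le_of_norm_le hlohi hbound (hcont.intervalIntegrable _ _)).trans ?_
  rw [intervalIntegral.integral_const_mul, intervalIntegral.integral_const_mul]
  have hI := integral_inv_abs_add_one_le (A := x + 1) (by linarith) (by linarith) hlohi hhi
  have : x + 1 + 1 = x + 2 := by ring
  rw [this] at hI
  calc K * (5 * ∫ t in lo..hi, (|t| + 1)⁻¹) ≤ K * (5 * (2 * Real.log (x + 2))) := by gcongr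
    _ = K * (10 * Real.log (x + 2)) := by ring

/-! ### The sum over the zeros, under RH -/

/-- **The zero sum under RH.** If all zeros of `ζ` with `Re ρ > 0` have `Re ρ = 1/2`, then for a
finite set `F` of zeros of `ζ₁` in `(a, b) × (lo, hi)` with `a ≥ 1/4`, `[lo, hi] ⊆ [−U, U]`,
`‖∑_{ρ ∈ F} m(ρ) x^ρ/ρ‖ ≤ x^{1/2} ∑ m(ρ)/|ρ| ≤ x^{1/2} · C log²(U + 2)` (MV (13.1)).
[cite: MontgomeryVaughan2007, §13.1 eq. (13.1)] -/
theorem norm_vonKoch_zeroSum_le (hRH : RiemannHypothesis) {C : ℝ}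
    (hC : ∀ U : ℝ, 1 ≤ U → ∀ F : Finset ℂ, (∀ ρ ∈ F, ρ ∈ zetaZerosRight ∧ |ρ.im| ≤ U) →
      ∑ ρ ∈ F, (riemannZetaZeroOrder ρ : ℝ) / ‖ρ‖ ≤ C * Real.log (U + 2) ^ 2)
    {x a b lo hi U : ℝ} (hx : 0 < x) (ha : 1 / 4 ≤ a) (hU : 1 ≤ U) (hlo : -U ≤ lo) (hhi : hi ≤ U)
    (F : Finset ℂ) (hF : ∀ ρ ∈ F, riemannZeta₁ ρ = 0 ∧ ρ ∈ Ioo a b ×ℂ Ioo lo hi) :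
    ‖∑ ρ ∈ F, ((meromorphicOrderAt riemannZeta₁ ρ).untop₀ : ℂ) * ((x : ℂ) ^ ρ / ρ)‖ ≤
      x ^ (1 / 2 : ℝ) * (C * Real.log (U + 2) ^ 2) := by
  have hterm : ∀ ρ ∈ F, ‖((meromorphicOrderAt riemannZeta₁ ρ).untop₀ : ℂ) * ((x : ℂ) ^ ρ / ρ)‖ =
      x ^ (1 / 2 : ℝ) * ((riemannZetaZeroOrder ρ : ℝ) / ‖ρ‖) := by
    intro ρ hρ
    obtain ⟨h0, hmem⟩ := hF ρ hρ
    have hρ1 : ρ ≠ 1 := ne_one_of_riemannZeta₁_eq_zero h0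
    have hζ : riemannZeta ρ = 0 := riemannZeta_eq_zero_of_riemannZeta₁ h0
    have hre' : a < ρ.re := (mem_reProdIm.1 hmem).1.1
    have hre : ρ.re = 1 / 2 := re_eq_one_half_of_riemannHypothesis hRH hζ (by linarith)
    have horder : (meromorphicOrderAt riemannZeta₁ ρ).untop₀ = riemannZetaZeroOrder ρ := by
      rw [meromorphicOrderAt_riemannZeta₁_eq hρ1]; rfl
    have hm : (0 : ℝ) ≤ riemannZetaZeroOrder ρ := riemannZetaZeroOrder_nonneg_of_zero hζ
    rw [horder, norm_mul, Complex.norm_intCast, abs_of_nonneg hm, norm_div,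
      Complex.norm_cpow_eq_rpow_re_of_pos hx, hre]
    ring
  have hmemF : ∀ ρ ∈ F, ρ ∈ zetaZerosRight ∧ |ρ.im| ≤ U := by
    intro ρ hρ
    obtain ⟨h0, hmem⟩ := hF ρ hρ
    have h' := mem_reProdIm.1 hmem
    refine ⟨⟨riemannZeta_eq_zero_of_riemannZeta₁ h0, by linarith [h'.1.1]⟩, ?_⟩
    rw [abs_le]
    constructor <;> linarith [h'.2.1, h'.2.2]
  calc ‖∑ ρ ∈ F, ((meromorphicOrderAt riemannZeta₁ ρ).untop₀ : ℂ) * ((x : ℂ) ^ ρ / ρ)‖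
      ≤ ∑ ρ ∈ F, ‖((meromorphicOrderAt riemannZeta₁ ρ).untop₀ : ℂ) * ((x : ℂ) ^ ρ / ρ)‖ :=
        norm_sum_le _ _
    _ = ∑ ρ ∈ F, x ^ (1 / 2 : ℝ) * ((riemannZetaZeroOrder ρ : ℝ) / ‖ρ‖) := Finset.sum_congr rfl hterm
    _ = x ^ (1 / 2 : ℝ) * ∑ ρ ∈ F, (riemannZetaZeroOrder ρ : ℝ) / ‖ρ‖ := by rw [Finset.mul_sum]
    _ ≤ x ^ (1 / 2 : ℝ) * (C * Real.log (U + 2) ^ 2) :=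
        mul_le_mul_of_nonneg_left (hC U hU F hmemF) (by positivity)

/-! ### Von Koch's theorem at half-integers -/

/-- Elementary: for `x ≥ 7/2`, `log(x + 5) ≤ 2 log x` (as `x + 5 ≤ x²`). [folklore] -/
lemma log_add_five_le {x : ℝ} (hx : 7 / 2 ≤ x) : Real.log (x + 5) ≤ 2 * Real.log x := by
  have h : x + 5 ≤ x ^ 2 := by nlinarith
  calc Real.log (x + 5) ≤ Real.log (x ^ 2) := Real.log_le_log (by linarith) h
    _ = 2 * Real.log x := by rw [Real.log_pow]; push_cast; ring

/-- **Bookkeeping for the contour.** From the boundary identity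
`B − T + iR − iL = 2πi (x − S)` (bottom, top, right, left sides; `S` the zero sum) and bounds for
`‖T‖, ‖B‖, ‖R − 2πp‖, ‖L‖, ‖S‖` one gets `|p − x| ≤ b_T + b_B + b_R + b_L + b_S`
(as `2π ≥ 1`). [folklore] -/
theorem abs_sub_le_of_vonKoch_identity {B T R L S : ℂ} {x p bT bB bR bL bS : ℝ}
    (h : B - T + I * R - I * L = 2 * π * I * ((x : ℂ) - S))
    (hT : ‖T‖ ≤ bT) (hB : ‖B‖ ≤ bB) (hR : ‖R - 2 * π * p‖ ≤ bR) (hL : ‖L‖ ≤ bL)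
    (hS : ‖S‖ ≤ bS) : |p - x| ≤ bT + bB + bR + bL + bS := by
  have key : 2 * π * I * ((p : ℂ) - x) =
      T - B - I * (R - 2 * π * p) + I * L - 2 * π * I * S := by
    linear_combination h
  have h2π : ‖(2 * π * I : ℂ)‖ = 2 * π := by
    rw [norm_mul, norm_mul, Complex.norm_I, mul_one, Complex.norm_real,
      Real.norm_of_nonneg Real.pi_pos.le, Complex.norm_two]
  have hl : ‖2 * π * I * ((p : ℂ) - x)‖ = 2 * π * |p - x| := by
    rw [norm_mul, h2π, ← ofReal_sub, Complex.norm_real, Real.norm_eq_abs]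
  have e1 : ‖I * (R - 2 * π * p)‖ = ‖R - 2 * π * p‖ := by rw [norm_mul, Complex.norm_I, one_mul]
  have e2 : ‖I * L‖ = ‖L‖ := by rw [norm_mul, Complex.norm_I, one_mul]
  have e3 : ‖2 * π * I * S‖ = 2 * π * ‖S‖ := by rw [norm_mul, h2π]
  have hnorm : 2 * π * |p - x| ≤ ‖T‖ + ‖B‖ + ‖R - 2 * π * p‖ + ‖L‖ + 2 * π * ‖S‖ := by
    rw [← hl, key]
    calc ‖T - B - I * (R - 2 * π * p) + I * L - 2 * π * I * S‖
        ≤ ‖T - B - I * (R - 2 * π * p) + I * L‖ + ‖2 * π * I * S‖ := norm_sub_le _ _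
      _ ≤ ‖T - B - I * (R - 2 * π * p)‖ + ‖I * L‖ + ‖2 * π * I * S‖ := by
          gcongr; exact norm_add_le _ _
      _ ≤ ‖T - B‖ + ‖I * (R - 2 * π * p)‖ + ‖I * L‖ + ‖2 * π * I * S‖ := by
          gcongr; exact norm_sub_le _ _
      _ ≤ ‖T‖ + ‖B‖ + ‖I * (R - 2 * π * p)‖ + ‖I * L‖ + ‖2 * π * I * S‖ := by
          gcongr; exact norm_sub_le _ _
      _ = ‖T‖ + ‖B‖ + ‖R - 2 * π * p‖ + ‖L‖ + 2 * π * ‖S‖ := by rw [e1, e2, e3]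
  have hπ1 : 1 ≤ 2 * π := by linarith [Real.pi_gt_three]
  have hπ0 : 0 < 2 * π := by positivity
  have h0 : 0 ≤ bT + bB + bR + bL := by
    linarith [norm_nonneg T, norm_nonneg B, norm_nonneg (R - 2 * π * p), norm_nonneg L]
  have hrest : ‖T‖ + ‖B‖ + ‖R - 2 * π * p‖ + ‖L‖ ≤ 2 * π * (bT + bB + bR + bL) :=
    calc ‖T‖ + ‖B‖ + ‖R - 2 * π * p‖ + ‖L‖ ≤ bT + bB + bR + bL := by linarith
      _ = 1 * (bT + bB + bR + bL) := (one_mul _).symm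
      _ ≤ 2 * π * (bT + bB + bR + bL) := mul_le_mul_of_nonneg_right hπ1 h0
  have hS' : 2 * π * ‖S‖ ≤ 2 * π * bS := mul_le_mul_of_nonneg_left hS hπ0.le
  have : 2 * π * |p - x| ≤ 2 * π * (bT + bB + bR + bL + bS) := by linarith
  exact le_of_mul_le_mul_left this hπ0

/-- **Von Koch's theorem at half-integers** (Montgomery–Vaughan Thm. 13.1, eq. (13.2)). Under RH
there is `K` with `|ψ(x) − x| ≤ K x^{1/2} log² x` for all `x = N + 1/2`, `N ≥ 3`.
[cite: MontgomeryVaughan2007, Thm. 13.1] -/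
theorem exists_abs_psi_sub_le_halfInt_of_riemannHypothesis (hRH : RiemannHypothesis) :
    ∃ K : ℝ, 0 < K ∧ ∀ N : ℕ, 3 ≤ N →
      |ψ ((N : ℝ) + 1 / 2) - ((N : ℝ) + 1 / 2)| ≤
        K * ((N : ℝ) + 1 / 2) ^ (1 / 2 : ℝ) * Real.log ((N : ℝ) + 1 / 2) ^ 2 := by
  obtain ⟨K₅, hK₅0, hK₅⟩ := exists_norm_perron_vonMangoldt_sub_le
  obtain ⟨c₀, hc₀0, hgood⟩ := ZetaLogDerivRH.exists_goodHeight
  obtain ⟨C_H, hCH0, hCH⟩ := norm_logDeriv_zeta_le_of_goodHeight hRH hc₀0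
  obtain ⟨C_L, hCL0, hCL⟩ := norm_logDeriv_zeta_quarter_le hRH
  obtain ⟨C_Z, hCZ0, hCZ⟩ := exists_sum_zeroOrder_div_norm_le
  refine ⟨4 * C_Z + K₅ + 16 * Real.exp 1 * C_H + 40 * C_L, by positivity, fun N hN ↦ ?_⟩
  set x : ℝ := (N : ℝ) + 1 / 2 with hxdef
  set c : ℝ := 1 + 1 / Real.log x with hcdef
  obtain ⟨hx0, hlog, hc1, hc2, hxc, hfloor⟩ := halfInt_facts (x := x) (c := c) hN hxdef hcdef
  have hN' : (3 : ℝ) ≤ N := by exact_mod_cast hN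
  have hx72 : 7 / 2 ≤ x := by rw [hxdef]; linarith
  have hx1 : 1 ≤ x := by linarith
  have e14 : ((1 / 4 : ℝ) : ℂ) = 1 / 4 := by push_cast; ring
  -- good heights `T₁ ∈ [x, x+1]`, `T₂ ∈ [−x−1, −x]`
  obtain ⟨T₁, hT₁mem, hT₁sep⟩ := hgood x
  obtain ⟨T₂, hT₂mem, hT₂sep⟩ := hgood (-x - 1)
  have hT₁x : x ≤ T₁ := hT₁mem.1
  have hT₁x' : T₁ ≤ x + 1 := hT₁mem.2
  have hT₂x : -x - 1 ≤ T₂ := hT₂mem.1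
  have hT₂x' : T₂ ≤ -x := by have := hT₂mem.2; linarith
  have hlo : T₂ < 0 := by linarith
  have hhi : 0 < T₁ := by linarith
  have hT₁abs : |T₁| = T₁ := abs_of_pos hhi
  have hT₂abs : |T₂| = -T₂ := abs_of_neg hlo
  have hT₁ := hCH T₁ (by rw [hT₁abs]; linarith) hT₁sep
  have hT₂ := hCH T₂ (by rw [hT₂abs]; linarith) hT₂sep
  -- non-vanishing of `ζ₁` on the four sides (`ζ₁(s) = 0 → ζ(s) = 0`)
  have h_bot : ∀ σ ∈ Icc (1 / 4 : ℝ) c, riemannZeta₁ (σ + T₂ * I) ≠ 0 := fun σ hσ ↦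
    mt riemannZeta_eq_zero_of_riemannZeta₁ (hT₂ σ ⟨hσ.1, hσ.2.trans hc2⟩).1
  have h_top : ∀ σ ∈ Icc (1 / 4 : ℝ) c, riemannZeta₁ (σ + T₁ * I) ≠ 0 := fun σ hσ ↦
    mt riemannZeta_eq_zero_of_riemannZeta₁ (hT₁ σ ⟨hσ.1, hσ.2.trans hc2⟩).1
  have h_left : ∀ t ∈ Icc T₂ T₁, riemannZeta₁ ((1 / 4 : ℝ) + t * I) ≠ 0 := fun t _ ↦ by
    rw [e14]; exact mt riemannZeta_eq_zero_of_riemannZeta₁ (hCL t).1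
  have h_right : ∀ t ∈ Icc T₂ T₁, riemannZeta₁ (c + t * I) ≠ 0 := fun t _ ↦
    mt riemannZeta_eq_zero_of_riemannZeta₁
      (riemannZeta_ne_zero_of_one_lt_re (by simp; exact hc1))
  -- (1) the residue identity, in four-term form
  have hId := rectBoundaryIntegral_vonKoch_eq hx0 (by norm_num : (0 : ℝ) < 1 / 4)
    (by norm_num : (1 / 4 : ℝ) < 1) hc1 hlo hhi h_bot h_top h_left h_right
  rw [Literature.Analysis.Complex.rectBoundaryIntegral_def] at hId
  -- (2) the right side: truncated Perron
  have hRψ : ‖(∫ t in T₂..T₁, (fun s : ℂ ↦ (-(deriv riemannZeta₁ s / riemannZeta₁ s) + (s - 1)⁻¹) *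
      ((x : ℂ) ^ s / s)) (c + t * I)) - 2 * π * ψ x‖ ≤ K₅ * Real.log x ^ 2 := by
    have hRe : (∫ t in T₂..T₁, (fun s : ℂ ↦ (-(deriv riemannZeta₁ s / riemannZeta₁ s) +
        (s - 1)⁻¹) * ((x : ℂ) ^ s / s)) (c + t * I)) =
        ∫ t in T₂..T₁, (-deriv riemannZeta (c + t * I) / riemannZeta (c + t * I)) *
          ((x : ℂ) ^ ((c : ℂ) + t * I) / ((c : ℂ) + t * I)) :=
      integral_congr fun t _ ↦ vonKochIntegrand_eq_of_one_lt x hc1 t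
    rw [hRe]
    have hP := hK₅ N hN x c hxdef hcdef T₁ (-T₂) hT₁x (by linarith)
    rw [neg_neg] at hP
    exact hP
  -- (3) horizontal sides
  have hlog0 : 0 ≤ Real.log x := by linarith
  have hMT : 0 ≤ C_H * Real.log (|T₁| + 2) ^ 2 := by positivity
  have hMB : 0 ≤ C_H * Real.log (|T₂| + 2) ^ 2 := by positivity
  have hTn := norm_vonKoch_horizontal_le hx1 hc1 hc2 hxc (by rw [hT₁abs]; exact hT₁x) hMT hT₁
  have hBn := norm_vonKoch_horizontal_le hx1 hc1 hc2 hxc (by rw [hT₂abs]; linarith) hMB hT₂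
  -- (4) left side
  have hlog3' : 0 ≤ Real.log (x + 3) := Real.log_nonneg (by linarith)
  have hML : 0 ≤ C_L * Real.log (x + 3) := by positivity
  have hLn := norm_vonKoch_left_le (lo := T₂) (hi := T₁) (M := C_L * Real.log (x + 3)) hx1
    (by linarith) (hlo.trans hhi).le hT₁x' hML (fun t ht ↦ by
      refine ⟨(hCL t).1, (hCL t).2.trans ?_⟩
      refine mul_le_mul_of_nonneg_left (Real.log_le_log (by positivity) ?_) hCL0.le
      have : |t| ≤ x + 1 := abs_le.2 ⟨by linarith [ht.1], by linarith [ht.2]⟩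
      linarith)
  -- (5) the zero sum
  have hfA : AnalyticOnNhd ℂ riemannZeta₁ (Icc (1 / 4 : ℝ) c ×ℂ Icc T₂ T₁) := fun s _ ↦
    differentiable_riemannZeta₁.analyticAt s
  have hcorner : ((1 / 4 : ℝ) : ℂ) + T₂ * I ∈ Icc (1 / 4 : ℝ) c ×ℂ Icc T₂ T₁ := by
    have hre : (((1 / 4 : ℝ) : ℂ) + T₂ * I).re = 1 / 4 := by simp
    have him : (((1 / 4 : ℝ) : ℂ) + T₂ * I).im = T₂ := by simp
    rw [mem_reProdIm, hre, him]
    exact ⟨⟨le_rfl, by linarith⟩, ⟨le_rfl, by linarith⟩⟩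
  have hfin := Literature.Analysis.Complex.finite_zeros_reProdIm (f := riemannZeta₁)
    (by linarith : (1 / 4 : ℝ) ≤ c) (hlo.trans hhi).le hfA hcorner (h_bot (1 / 4) ⟨le_rfl, by linarith⟩)
  have hSn : ‖∑ᶠ ρ ∈ {ρ : ℂ | riemannZeta₁ ρ = 0 ∧ ρ ∈ Ioo (1 / 4 : ℝ) c ×ℂ Ioo T₂ T₁},
      ((meromorphicOrderAt riemannZeta₁ ρ).untop₀ : ℂ) * ((x : ℂ) ^ ρ / ρ)‖ ≤
      x ^ (1 / 2 : ℝ) * (C_Z * Real.log (x + 1 + 2) ^ 2) := by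
    rw [finsum_mem_eq_finite_toFinset_sum _ hfin]
    refine norm_vonKoch_zeroSum_le hRH hCZ (a := 1 / 4) (b := c) (lo := T₂) (hi := T₁)
      (U := x + 1) hx0 le_rfl (by linarith) (by linarith) hT₁x' hfin.toFinset fun ρ hρ ↦ ?_
    simpa using hρ
  -- (6) combine
  have hfinal := abs_sub_le_of_vonKoch_identity hId hTn hBn hRψ hLn hSn
  -- (7) numerical bookkeeping: everything is `≪ x^{1/2} log² x`
  set Lx : ℝ := Real.log x with hLx
  set r : ℝ := x ^ (1 / 2 : ℝ) with hr
  have hr1 : 1 ≤ r := Real.one_le_rpow hx1 (by norm_num)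
  have hr4 : x ^ (1 / 4 : ℝ) ≤ r := Real.rpow_le_rpow_of_exponent_le hx1 (by norm_num)
  have hL1 : 1 ≤ Lx := hlog
  have hLx2 : 1 ≤ Lx ^ 2 := one_le_pow₀ hL1
  have hrL : Lx ^ 2 ≤ r * Lx ^ 2 := le_mul_of_one_le_left (sq_nonneg Lx) hr1
  have hrL0 : 0 ≤ r * Lx ^ 2 := by positivity
  have hlogT₁ : Real.log (|T₁| + 2) ≤ 2 * Lx := by
    rw [hT₁abs]
    exact le_trans (Real.log_le_log (by linarith) (by linarith)) (log_add_five_le hx72)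
  have hlogT₂ : Real.log (|T₂| + 2) ≤ 2 * Lx := by
    rw [hT₂abs]
    exact le_trans (Real.log_le_log (by linarith) (by linarith)) (log_add_five_le hx72)
  have hlog2 : Real.log (x + 2) ≤ 2 * Lx :=
    le_trans (Real.log_le_log (by linarith) (by linarith)) (log_add_five_le hx72)
  have hlog12 : Real.log (x + 1 + 2) ≤ 2 * Lx :=
    le_trans (Real.log_le_log (by linarith) (by linarith)) (log_add_five_le hx72)
  have hlog3 : Real.log (x + 3) ≤ 2 * Lx :=
    le_trans (Real.log_le_log (by linarith) (by linarith)) (log_add_five_le hx72)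
  have hlog2' : 0 ≤ Real.log (x + 2) := Real.log_nonneg (by linarith)
  have hlog12' : 0 ≤ Real.log (x + 1 + 2) := Real.log_nonneg (by linarith)
  -- T and B
  have hTB : ∀ {y : ℝ}, Real.log y ≤ 2 * Lx → 0 ≤ Real.log y →
      2 * Real.exp 1 * (C_H * Real.log y ^ 2) ≤ 8 * Real.exp 1 * C_H * (r * Lx ^ 2) := by
    intro y hy hy0
    have h1 : Real.log y ^ 2 ≤ 4 * Lx ^ 2 :=
      calc Real.log y ^ 2 ≤ (2 * Lx) ^ 2 := pow_le_pow_left₀ hy0 hy 2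
        _ = 4 * Lx ^ 2 := by ring
    have h2 : Real.log y ^ 2 ≤ 4 * (r * Lx ^ 2) := by linarith
    have he : 0 ≤ 2 * Real.exp 1 * C_H := by positivity
    calc 2 * Real.exp 1 * (C_H * Real.log y ^ 2) = 2 * Real.exp 1 * C_H * Real.log y ^ 2 := by ring
      _ ≤ 2 * Real.exp 1 * C_H * (4 * (r * Lx ^ 2)) := mul_le_mul_of_nonneg_left h2 he
      _ = _ := by ring
  have hT' := hTB hlogT₁ (Real.log_nonneg (by linarith [abs_nonneg T₁]))
  have hB' := hTB hlogT₂ (Real.log_nonneg (by linarith [abs_nonneg T₂]))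
  -- R
  have hR' : K₅ * Lx ^ 2 ≤ K₅ * (r * Lx ^ 2) := mul_le_mul_of_nonneg_left hrL hK₅0.le
  -- L
  have hL' : x ^ (1 / 4 : ℝ) * (C_L * Real.log (x + 3)) * (10 * Real.log (x + 2)) ≤
      40 * C_L * (r * Lx ^ 2) := by
    have h1 : C_L * Real.log (x + 3) ≤ C_L * (2 * Lx) := mul_le_mul_of_nonneg_left hlog3 hCL0.le
    have h2 : 10 * Real.log (x + 2) ≤ 20 * Lx := by linarith
    calc x ^ (1 / 4 : ℝ) * (C_L * Real.log (x + 3)) * (10 * Real.log (x + 2))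
        ≤ r * (C_L * (2 * Lx)) * (20 * Lx) :=
          mul_le_mul (mul_le_mul hr4 h1 hML (by positivity)) h2 (by linarith)
            (mul_nonneg (by positivity) (mul_nonneg hCL0.le (by linarith)))
      _ = 40 * C_L * (r * Lx ^ 2) := by ring
  -- S
  have hS' : r * (C_Z * Real.log (x + 1 + 2) ^ 2) ≤ 4 * C_Z * (r * Lx ^ 2) := by
    have h1 : Real.log (x + 1 + 2) ^ 2 ≤ 4 * Lx ^ 2 :=
      calc Real.log (x + 1 + 2) ^ 2 ≤ (2 * Lx) ^ 2 := pow_le_pow_left₀ hlog12' hlog12 2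
        _ = 4 * Lx ^ 2 := by ring
    calc r * (C_Z * Real.log (x + 1 + 2) ^ 2) ≤ r * (C_Z * (4 * Lx ^ 2)) := by gcongr
      _ = 4 * C_Z * (r * Lx ^ 2) := by ring
  -- conclusion
  calc |ψ x - x| ≤ _ := hfinal
    _ ≤ (4 * C_Z + K₅ + 16 * Real.exp 1 * C_H + 40 * C_L) * (r * Lx ^ 2) := by linarith
    _ = _ := by ring

/-! ### Von Koch's theorem -/

/-- **Von Koch's theorem** (von Koch 1901; Montgomery–Vaughan Thm. 13.1, eq. (13.2)): the Riemann
hypothesis implies `ψ(x) = x + O(x^{1/2} log² x)`. This discharges the tree's named fact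
`Literature.NumberTheory.LFunctions.vonKoch_chebyshevPsi_of_riemannHypothesis`. [cite: Koch1901, main theorem] -/
theorem vonKoch_chebyshevPsi_of_riemannHypothesis_holds :
    vonKoch_chebyshevPsi_of_riemannHypothesis := by
  intro hRH
  show (fun x ↦ ψ x - x) =O[atTop] fun x ↦ x ^ (1 / 2 : ℝ) * Real.log x ^ 2
  obtain ⟨K, hK0, hK⟩ := exists_abs_psi_sub_le_halfInt_of_riemannHypothesis hRH
  refine IsBigO.of_bound (8 * K + 1) ?_
  filter_upwards [eventually_ge_atTop (4 : ℝ)] with x hx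
  show ‖ψ x - x‖ ≤ (8 * K + 1) * ‖x ^ (1 / 2 : ℝ) * Real.log x ^ 2‖
  have hx0 : 0 < x := by linarith
  obtain ⟨N, hNdef⟩ : ∃ N : ℕ, ⌊x⌋₊ = N := ⟨_, rfl⟩
  have hN3 : 3 ≤ N := by rw [← hNdef]; exact Nat.le_floor (by push_cast; linarith)
  have hNx : (N : ℝ) ≤ x := by rw [← hNdef]; exact Nat.floor_le hx0.le
  have hxN : x < N + 1 := by rw [← hNdef]; exact Nat.lt_floor_add_one x
  have hN3' : (3 : ℝ) ≤ N := by exact_mod_cast hN3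
  obtain ⟨x', hx'⟩ : ∃ x' : ℝ, x' = (N : ℝ) + 1 / 2 := ⟨_, rfl⟩
  have hx'0 : 0 < x' := by rw [hx']; positivity
  have hfloor' : ⌊x'⌋₊ = N := by
    rw [hx', Nat.floor_eq_iff (by positivity)]
    constructor <;> linarith
  have hψ : ψ x = ψ x' := by
    rw [Chebyshev.psi_eq_psi_coe_floor x, Chebyshev.psi_eq_psi_coe_floor x', hfloor', hNdef]
  have hmain := hK N hN3
  rw [← hx'] at hmain
  -- compare `x'` with `x`
  have hxx' : |x' - x| ≤ 1 / 2 := by rw [abs_le]; constructor <;> linarith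
  have hx'le : x' ≤ 4 * x := by linarith
  have h4 : (4 : ℝ) ^ (1 / 2 : ℝ) = 2 := by
    rw [show (4 : ℝ) = (2 : ℝ) ^ (2 : ℕ) by norm_num, ← Real.rpow_natCast,
      ← Real.rpow_mul (by norm_num)]
    norm_num
  have hsqrt : x' ^ (1 / 2 : ℝ) ≤ 2 * x ^ (1 / 2 : ℝ) := by
    calc x' ^ (1 / 2 : ℝ) ≤ (4 * x) ^ (1 / 2 : ℝ) :=
          Real.rpow_le_rpow hx'0.le hx'le (by norm_num)
      _ = (4 : ℝ) ^ (1 / 2 : ℝ) * x ^ (1 / 2 : ℝ) := Real.mul_rpow (by norm_num) hx0.le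
      _ = 2 * x ^ (1 / 2 : ℝ) := by rw [h4]
  have hlog2x : Real.log 2 ≤ Real.log x := Real.log_le_log two_pos (by linarith)
  have hlogx1 : 1 ≤ Real.log x := by
    rw [← Real.log_exp 1]
    refine Real.log_le_log (Real.exp_pos 1) ?_
    have := Real.exp_one_lt_d9; linarith
  have hlogx' : Real.log x' ≤ 2 * Real.log x := by
    calc Real.log x' ≤ Real.log (2 * x) := Real.log_le_log hx'0 (by linarith)
      _ = Real.log 2 + Real.log x := Real.log_mul two_ne_zero hx0.ne'
      _ ≤ 2 * Real.log x := by linarith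
  have hlogx'0 : 0 ≤ Real.log x' := Real.log_nonneg (by linarith)
  have hr0 : 0 ≤ x ^ (1 / 2 : ℝ) := by positivity
  have hr1 : 1 ≤ x ^ (1 / 2 : ℝ) := Real.one_le_rpow (by linarith) (by norm_num)
  have hl : Real.log x' ^ 2 ≤ 4 * Real.log x ^ 2 :=
    calc Real.log x' ^ 2 ≤ (2 * Real.log x) ^ 2 := pow_le_pow_left₀ hlogx'0 hlogx' 2
      _ = 4 * Real.log x ^ 2 := by ring
  have h1 : K * x' ^ (1 / 2 : ℝ) * Real.log x' ^ 2 ≤ 8 * K * (x ^ (1 / 2 : ℝ) * Real.log x ^ 2) := by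
    calc K * x' ^ (1 / 2 : ℝ) * Real.log x' ^ 2
        ≤ K * (2 * x ^ (1 / 2 : ℝ)) * (4 * Real.log x ^ 2) :=
          mul_le_mul (mul_le_mul_of_nonneg_left hsqrt hK0.le) hl (sq_nonneg _) (by positivity)
      _ = 8 * K * (x ^ (1 / 2 : ℝ) * Real.log x ^ 2) := by ring
  have hL2 : 1 ≤ Real.log x ^ 2 := one_le_pow₀ hlogx1
  have h2 : (1 / 2 : ℝ) ≤ x ^ (1 / 2 : ℝ) * Real.log x ^ 2 := by
    have : (1 : ℝ) ≤ x ^ (1 / 2 : ℝ) * Real.log x ^ 2 := by nlinarith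
    linarith
  rw [Real.norm_eq_abs, Real.norm_of_nonneg (by positivity)]
  calc |ψ x - x| = |(ψ x' - x') + (x' - x)| := by rw [hψ]; ring_nf
    _ ≤ |ψ x' - x'| + |x' - x| := abs_add_le _ _
    _ ≤ K * x' ^ (1 / 2 : ℝ) * Real.log x' ^ 2 + 1 / 2 := add_le_add hmain hxx'
    _ ≤ 8 * K * (x ^ (1 / 2 : ℝ) * Real.log x ^ 2) + x ^ (1 / 2 : ℝ) * Real.log x ^ 2 :=
        add_le_add h1 h2
    _ = (8 * K + 1) * (x ^ (1 / 2 : ℝ) * Real.log x ^ 2) := by ring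

end Literature.NumberTheory.LFunctions

end
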